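import Summits.AtomisticToContinuum.FouriersLaw.Theses.ContactStieltjesMeasure
import Mathlib.Analysis.SpecialFunctions.ImproperIntegrals
import Mathlib.MeasureTheory.Function.SpecialFunctions.Basic

/-!
# Re-cut note for `ContactUpperDensity` (stmt-AtomisticToContinuum-15249) — checked part

Scratch evidence (planner, crux-ideate k1 g6).  Nothing here is proposed to the tree.

`closes` of route `ContactStieltjesMeasure` consumes `ContactUpperDensity` (U) at exactly one
place: `obtain ⟨C, N₀, hC⟩ := hUD …` builds the dominated-convergence majorant
`C * (1 + t) * (2 * t / (γ ^ 2 + t ^ 2) ^ 2)` (bounded by `K γ * (1 + t ^ 2)⁻¹`, integrable).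
Any eventually-in-`N` uniform bound `N * Φ N t ≤ C * (1 + t) ^ a` with `a < 2` gives an
integrable majorant too (`majorant_integrable`), so the WEAKER statement
`ContactUpperDensityWeak` (U_w) already suffices for the assembly; (U) ⇒ (U_w) is
`weak_of_strong` (`a = 1`).  In conductance language (via `FrictionGrid.sandwich`,
`Φ_N(γ) ≤ 2γ G_N(γ)`): (U_w) follows from ANY power saving `N * G_N(γ) ≤ C * γ ^ (1 - ε)`
on `γ ≥ 1`, whereas (U) needs `N * G_N(γ) ≤ C`; the free Stieltjes transfer from
`BoundedResponse` at `γ = 1` gives `N * G_N(γ) ≤ C * γ` (ε = 0), which misses by one log.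
-/

namespace Summit.AtomisticToContinuum.FouriersLaw.Cruxes.ContactUpperDensity.Recut

open MeasureTheory Set
open Summit.AtomisticToContinuum.FouriersLaw.Theses.ContactStieltjesMeasure

/-- (U_w): same binders as `ContactUpperDensity`; conclusion weakened from `C * (1 + t)` to
`C * (1 + t) ^ a` for SOME real exponent `a < 2` (the weakest power form the dominated
convergence in `closes` tolerates: `(1 + t) ^ a * (2 t / (γ² + t²)²) ~ 2 t ^ (a - 3)`). -/
def ContactUpperDensityWeak : Prop :=
  ∀ ω₂ lam β : ℝ, 0 < ω₂ → 0 < lam → 0 < β → ∀ T : ℝ, 0 < T → ∀ Φ : ℕ → ℝ → ℝ, (∀ N : ℕ, 2 ≤ N → Monotone (Φ N) ∧ (∀ s : ℝ, s ≤ 0 → Φ N s = 0) ∧ (∃ m : ℝ, ∀ s : ℝ, Φ N s ≤ m) ∧ ∀ γ : ℝ, 0 < γ → (∀ (N' : ℕ) (T_L T_R : ℝ), 0 < T_L → 0 < T_R → ∀ μ ν : MeasureTheory.Measure (Literature.MathematicalPhysics.KineticTheory.HeatConduction.PhaseSpace N'), (Literature.MathematicalPhysics.KineticTheory.HeatConduction.pinnedChain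 ω₂ lam β γ).IsSteadyState N' T_L T_R μ → (Literature.MathematicalPhysics.KineticTheory.HeatConduction.pinnedChain ω₂ lam β γ).IsSteadyState N' T_L T_R ν → μ = ν) → ∀ μ : (N' : ℕ) → ℝ → ℝ → MeasureTheory.Measure (Literature.MathematicalPhysics.KineticTheory.HeatConduction.PhaseSpace N'), (∀ (N' : ℕ) (T_L T_R : ℝ), 0 < T_L → 0 < T_R → (Literature.MathematicalPhysics.KineticTheory.HeatConduction.pinnedChain ω₂ lam β γ).IsSteadyState N' T_L T_R (μ N' T_L T_R)) → Filter.Tendsto (fun δ : ℝ => (Literature.MathematicalPhysics.KineticTheory.HeatConduction.pinnedChain ω₂ lam β γ).totalCurrent (μ N (T + δ / 2) (T - δ / 2)) / δ) (nhdsWithin 0 {(0 : ℝ)}ᶜ) (nhds (((N : ℝ) - 1) * γ * ∫ t in Set.Ioi (0 : ℝ), Φ N t * (2 * t / (γ ^ 2 + t ^ 2) ^ 2)))) → ∃ a : ℝ, a < 2 ∧ ∃ C : ℝ, ∃ N₀ : ℕ, ∀ N : ℕ, N₀ ≤ N → ∀ t : ℝ, 0 < t → (N : ℝ) * Φ N t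 ≤ C * (1 + t) ^ a

/-- (U) ⇒ (U_w) with `a = 1`. -/
theorem weak_of_strong (h : ContactUpperDensity) : ContactUpperDensityWeak := by
  intro ω₂ lam β hω hl hβ T hT Φ hΦ
  obtain ⟨C, N₀, hC⟩ := h ω₂ lam β hω hl hβ T hT Φ hΦ
  refine ⟨1, by norm_num, C, N₀, fun N hN t ht => ?_⟩
  rw [Real.rpow_one]
  exact hC N hN t ht

/-- Pointwise domination of the weak majorant by an integrable power of `1 + t`. -/
theorem majorant_le (a γ : ℝ) (hγ : 0 < γ) (t : ℝ) (ht : 0 < t) :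
    (1 + t) ^ a * (2 * t / (γ ^ 2 + t ^ 2) ^ 2) ≤ (16 + 16 / γ ^ 4) * (1 + t) ^ (a - 3) := by
  have h1t : 0 < 1 + t := by linarith
  have h1t3 : 0 < (1 + t) ^ 3 := by positivity
  have hγ2 : 0 < γ ^ 2 := by positivity
  have hγ4 : 0 < γ ^ 4 := by positivity
  have hden : 0 < (γ ^ 2 + t ^ 2) ^ 2 := by positivity
  -- the polynomial inequality `2 t (1+t)^3 ≤ (16 + 16/γ^4) (γ²+t²)²`
  have hA : 2 * t * (1 + t) ^ 3 ≤ 16 + 16 * t ^ 4 := by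
    nlinarith [sq_nonneg (t - 1), sq_nonneg (t ^ 2 - 1), sq_nonneg (t ^ 2 - t), sq_nonneg t,
      mul_pos ht ht, ht.le, mul_nonneg ht.le (sq_nonneg (t - 1)),
      mul_nonneg (mul_nonneg ht.le ht.le) (sq_nonneg (t - 1))]
  have hB : 16 * t ^ 4 ≤ 16 * (γ ^ 2 + t ^ 2) ^ 2 := by
    nlinarith [sq_nonneg (γ * t), hγ2, sq_nonneg t, mul_nonneg hγ2.le (sq_nonneg t)]
  have hC : (16 : ℝ) ≤ 16 / γ ^ 4 * (γ ^ 2 + t ^ 2) ^ 2 := by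
    rw [div_mul_eq_mul_div, le_div_iff₀ hγ4]
    have hγ4' : γ ^ 4 = (γ ^ 2) ^ 2 := by ring
    rw [hγ4']
    nlinarith [sq_nonneg t, mul_nonneg hγ2.le (sq_nonneg t), sq_nonneg (t ^ 2)]
  have hpoly : 2 * t * (1 + t) ^ 3 ≤ (16 + 16 / γ ^ 4) * (γ ^ 2 + t ^ 2) ^ 2 := by
    nlinarith [hA, hB, hC]
  have hw : 2 * t / (γ ^ 2 + t ^ 2) ^ 2 ≤ (16 + 16 / γ ^ 4) / (1 + t) ^ 3 := by
    rw [div_le_div_iff₀ hden h1t3]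
    linarith [hpoly]
  have hrpow : (1 + t) ^ (a - 3) = (1 + t) ^ a / (1 + t) ^ 3 := by
    rw [Real.rpow_sub h1t, Real.rpow_ofNat]
  calc (1 + t) ^ a * (2 * t / (γ ^ 2 + t ^ 2) ^ 2)
      ≤ (1 + t) ^ a * ((16 + 16 / γ ^ 4) / (1 + t) ^ 3) :=
        mul_le_mul_of_nonneg_left hw (Real.rpow_nonneg h1t.le a)
    _ = (16 + 16 / γ ^ 4) * (1 + t) ^ (a - 3) := by rw [hrpow]; ring

/-- For every real `a < 2` and `γ > 0` the weak majorant is integrable on `(0, ∞)`: this is the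
integrability input a re-glued `closes` needs in place of `integrable_inv_one_add_sq`. -/
theorem majorant_integrable (a : ℝ) (ha : a < 2) (γ : ℝ) (hγ : 0 < γ) :
    IntegrableOn (fun t : ℝ => (1 + t) ^ a * (2 * t / (γ ^ 2 + t ^ 2) ^ 2)) (Ioi 0) := by
  have h0 : IntegrableOn (fun t : ℝ => (t + 1) ^ (a - 3)) (Ioi 0) :=
    integrableOn_add_rpow_Ioi_of_lt (a := a - 3) (c := (0 : ℝ)) (m := (1 : ℝ))
      (by linarith) (by norm_num)
  have h1 : IntegrableOn (fun t : ℝ => (1 + t) ^ (a - 3)) (Ioi 0) :=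
    h0.congr_fun (fun x _ => by rw [add_comm]) measurableSet_Ioi
  have hint : IntegrableOn (fun t : ℝ => (16 + 16 / γ ^ 4) * (1 + t) ^ (a - 3)) (Ioi 0) :=
    MeasureTheory.Integrable.const_mul h1 _
  refine MeasureTheory.Integrable.mono' hint ?_ ?_
  · have hm : Measurable (fun t : ℝ => (1 + t) ^ a * (2 * t / (γ ^ 2 + t ^ 2) ^ 2)) := by
      fun_prop
    exact hm.aestronglyMeasurable
  · refine (ae_restrict_iff' measurableSet_Ioi).2 (Filter.Eventually.of_forall fun t ht => ?_)
    have ht' : 0 < t := ht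
    have hnn : 0 ≤ (1 + t) ^ a * (2 * t / (γ ^ 2 + t ^ 2) ^ 2) := by
      have : 0 ≤ 2 * t / (γ ^ 2 + t ^ 2) ^ 2 := by positivity
      exact mul_nonneg (Real.rpow_nonneg (by linarith) a) this
    rw [Real.norm_eq_abs, abs_of_nonneg hnn]
    exact majorant_le a γ hγ t ht'

/-- The dominating function a re-glued `closes` would use under (U_w). -/
theorem weak_dominator_integrable (a C : ℝ) (ha : a < 2) (γ : ℝ) (hγ : 0 < γ) :
    IntegrableOn (fun t : ℝ => C * (1 + t) ^ a * (2 * t / (γ ^ 2 + t ^ 2) ^ 2)) (Ioi 0) := by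
  have h : IntegrableOn (fun t : ℝ => C * ((1 + t) ^ a * (2 * t / (γ ^ 2 + t ^ 2) ^ 2))) (Ioi 0) :=
    MeasureTheory.Integrable.const_mul (majorant_integrable a ha γ hγ) C
  exact MeasureTheory.IntegrableOn.congr_fun h (fun x _ => by ring) measurableSet_Ioi

/-- `closes` of the route re-glued from the WEAK crux (U_w): verbatim copy of the gate-written
`closes` (route file lines 383–563) with `hUD : ContactUpperDensityWeak`; only the dominated-
convergence majorant changes (`C * (1 + t) ^ a * w γ t`, integrable by
`weak_dominator_integrable`).  Certifies: (U_w) ∧ StieltjesRepresentation ∧ ContactMeasureLimit ∧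
ConductanceLowerBound ⊢ FouriersLaw. -/
theorem closes_weak (hRep : StieltjesRepresentation) (hUD : ContactUpperDensityWeak)
    (hLim : ContactMeasureLimit) (hP : ConductanceLowerBound) : _root_.FouriersLaw := by
  -- crux-only hypotheses (D-0027 §2.1): weak-NESS uniqueness (stmt-0741) is PROVED in the tree and invoked here;
  have hU : Summit.AtomisticToContinuum.FouriersLaw.Theses.EmbeddedDrudeMourre.NessUnique :=
    Summit.AtomisticToContinuum.FouriersLaw.Theorems.nessUnique_proof
  intro ω₂ lam β γ hω hl hβ hγ
  have huniq := hU ω₂ lam β γ hω hl hβ hγ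
  have hex := fun (N : ℕ) (T_L T_R : ℝ) (hL : 0 < T_L) (hR : 0 < T_R) =>
    Literature.MathematicalPhysics.KineticTheory.HeatConduction.pinnedChain_exists_isSteadyState hω hl hβ hγ N hL hR
  refine ⟨fun N T_L T_R hL hR => ?_, ?_⟩
  ·
    obtain ⟨μ, hμ⟩ := hex N T_L T_R hL hR
    exact ⟨μ, hμ, fun ν hν => huniq N T_L T_R hL hR ν μ hν hμ⟩
  classical
  let μ₀ : (N : ℕ) → ℝ → ℝ →
      MeasureTheory.Measure (Literature.MathematicalPhysics.KineticTheory.HeatConduction.PhaseSpace N) :=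
    fun N T_L T_R => if h : 0 < T_L ∧ 0 < T_R then Classical.choose (hex N T_L T_R h.1 h.2) else 0
  have hμ₀ : ∀ (N : ℕ) (T_L T_R : ℝ), 0 < T_L → 0 < T_R →
      (Literature.MathematicalPhysics.KineticTheory.HeatConduction.pinnedChain ω₂ lam β γ).IsSteadyState N T_L T_R
        (μ₀ N T_L T_R) := by
    intro N T_L T_R hL hR
    simp only [μ₀, dif_pos (And.intro hL hR)]
    exact Classical.choose_spec (hex N T_L T_R hL hR)
  have hγ2 : 0 < γ ^ 2 := by positivity
  have hden : ∀ t : ℝ, 0 < (γ ^ 2 + t ^ 2) ^ 2 := fun t => by positivity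
  have hw_nonneg : ∀ t : ℝ, 0 ≤ t → 0 ≤ 2 * t / (γ ^ 2 + t ^ 2) ^ 2 := fun t ht =>
    div_nonneg (by linarith) (hden t).le
  have hw_cont : Continuous fun t : ℝ => 2 * t / (γ ^ 2 + t ^ 2) ^ 2 := by
    refine Continuous.div (by fun_prop) (by fun_prop) fun t => (hden t).ne'
  have key : ∀ T : ℝ, 0 < T → ∃ κT : ℝ, 0 < κT ∧ ∃ D : ℕ → ℝ,
      (∀ N : ℕ, Filter.Tendsto (fun δ : ℝ =>
        (Literature.MathematicalPhysics.KineticTheory.HeatConduction.pinnedChain ω₂ lam β γ).totalCurrent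
          (μ₀ N (T + δ / 2) (T - δ / 2)) / δ) (nhdsWithin 0 {(0 : ℝ)}ᶜ) (nhds (D N))) ∧
      Filter.Tendsto D Filter.atTop (nhds κT) := by
    intro T hT
    obtain ⟨Φ, hΦ⟩ := hRep ω₂ lam β hω hl.le hβ.le T hT
    let D : ℕ → ℝ := fun N => if 2 ≤ N then
      ((N : ℝ) - 1) * γ * ∫ t in Set.Ioi (0 : ℝ), Φ N t * (2 * t / (γ ^ 2 + t ^ 2) ^ 2) else 0
    have hDN : ∀ N : ℕ, 2 ≤ N →
        D N = ((N : ℝ) - 1) * γ * ∫ t in Set.Ioi (0 : ℝ), Φ N t * (2 * t / (γ ^ 2 + t ^ 2) ^ 2) :=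
      fun N hN => if_pos hN
    have hD : ∀ N : ℕ, Filter.Tendsto (fun δ : ℝ =>
        (Literature.MathematicalPhysics.KineticTheory.HeatConduction.pinnedChain ω₂ lam β γ).totalCurrent
          (μ₀ N (T + δ / 2) (T - δ / 2)) / δ) (nhdsWithin 0 {(0 : ℝ)}ᶜ) (nhds (D N)) := by
      intro N
      by_cases hN : 2 ≤ N
      · rw [hDN N hN]
        exact (hΦ N hN).2.2.2 γ hγ huniq μ₀ hμ₀
      ·
        have hD0 : D N = 0 := if_neg hN
        rw [hD0]
        have hj : ∀ (i : Fin N) (x : Literature.MathematicalPhysics.KineticTheory.HeatConduction.PhaseSpace N),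
            (Literature.MathematicalPhysics.KineticTheory.HeatConduction.pinnedChain ω₂ lam β γ).bondCurrent N i x = 0 :=
          fun i x => by
            unfold Literature.MathematicalPhysics.KineticTheory.HeatConduction.OscillatorChain.bondCurrent
            refine Finset.sum_eq_zero fun j _ => ?_
            have hji : ¬ (j.val = i.val + 1) := by have := j.isLt; omega
            rw [if_neg hji]
        have e : (fun δ : ℝ =>
            (Literature.MathematicalPhysics.KineticTheory.HeatConduction.pinnedChain ω₂ lam β γ).totalCurrent
              (μ₀ N (T + δ / 2) (T - δ / 2)) / δ) = fun _ => 0 := by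
          funext δ
          have : (Literature.MathematicalPhysics.KineticTheory.HeatConduction.pinnedChain ω₂ lam β γ).totalCurrent
              (μ₀ N (T + δ / 2) (T - δ / 2)) = 0 := by
            unfold Literature.MathematicalPhysics.KineticTheory.HeatConduction.OscillatorChain.totalCurrent
            exact Finset.sum_eq_zero fun i _ => by simp only [hj, MeasureTheory.integral_zero]
          rw [this, zero_div]
        rw [e]
        exact tendsto_const_nhds
    obtain ⟨a, ha2, C, N₀, hC⟩ := hUD ω₂ lam β hω hl hβ T hT Φ hΦ
    obtain ⟨M, hMmono, hM⟩ := hLim ω₂ lam β hω hl hβ T hT Φ hΦ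
    have hΦ_nonneg : ∀ N : ℕ, 2 ≤ N → ∀ t : ℝ, 0 ≤ t → 0 ≤ Φ N t := by
      intro N hN t ht
      have h0 : Φ N 0 = 0 := (hΦ N hN).2.1 0 le_rfl
      simpa [h0] using (hΦ N hN).1 ht
    have hC_nonneg : 0 ≤ C := by
      have h := hC (max N₀ 2) (le_max_left _ _) 1 one_pos
      have h' : 0 ≤ ((max N₀ 2 : ℕ) : ℝ) * Φ (max N₀ 2) 1 :=
        mul_nonneg (Nat.cast_nonneg _) (hΦ_nonneg _ (le_max_right _ _) 1 zero_le_one)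
      have h2a : 0 < (1 + (1 : ℝ)) ^ a := Real.rpow_pos_of_pos (by norm_num) a
      refine le_of_not_gt fun hneg => ?_
      have : C * (1 + (1 : ℝ)) ^ a < 0 := mul_neg_of_neg_of_pos hneg h2a
      linarith
    set L : ℝ := ∫ t in Set.Ioi (0 : ℝ), M t * (2 * t / (γ ^ 2 + t ^ 2) ^ 2) with hL
    have hDCT : Filter.Tendsto (fun N : ℕ => ∫ t in Set.Ioi (0 : ℝ),
        ((N : ℝ) * Φ N t) * (2 * t / (γ ^ 2 + t ^ 2) ^ 2)) Filter.atTop (nhds L) := by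
      refine MeasureTheory.tendsto_integral_filter_of_dominated_convergence
        (fun t => C * (1 + t) ^ a * (2 * t / (γ ^ 2 + t ^ 2) ^ 2)) ?_ ?_ ?_ ?_
      ·
        refine Filter.eventually_atTop.2 ⟨2, fun N hN => ?_⟩
        exact ((measurable_const.mul (hΦ N hN).1.measurable).mul hw_cont.measurable).aestronglyMeasurable
      ·
        refine Filter.eventually_atTop.2 ⟨max N₀ 2, fun N hN => ?_⟩
        refine (MeasureTheory.ae_restrict_iff' measurableSet_Ioi).2 (Filter.Eventually.of_forall fun t ht => ?_)
        have ht : 0 < t := ht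
        have h1 : 0 ≤ (N : ℝ) * Φ N t :=
          mul_nonneg (Nat.cast_nonneg _) (hΦ_nonneg N (le_trans (le_max_right _ _) hN) t ht.le)
        rw [Real.norm_eq_abs, abs_of_nonneg (mul_nonneg h1 (hw_nonneg t ht.le))]
        exact mul_le_mul_of_nonneg_right (hC N (le_trans (le_max_left _ _) hN) t ht) (hw_nonneg t ht.le)
      ·
        exact weak_dominator_integrable a C ha2 γ hγ
      ·
        have hS : MeasureTheory.volume {t : ℝ | ¬ContinuousAt M t} = 0 :=
          hMmono.countable_not_continuousAt.measure_zero _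
        have hae : ∀ᵐ t ∂(MeasureTheory.volume.restrict (Set.Ioi (0 : ℝ))), ContinuousAt M t := by
          refine MeasureTheory.ae_restrict_of_ae ?_
          rw [MeasureTheory.ae_iff]
          simpa using hS
        filter_upwards [hae, MeasureTheory.ae_restrict_mem measurableSet_Ioi] with t hcont ht
        exact (hM t ht hcont).mul_const _
    have hfrac : Filter.Tendsto (fun N : ℕ => ((N : ℝ) - 1) / N) Filter.atTop (nhds 1) := by
      have h : Filter.Tendsto (fun N : ℕ => (1 : ℝ) - 1 / (N : ℝ)) Filter.atTop (nhds (1 - 0)) :=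
        tendsto_const_nhds.sub tendsto_one_div_atTop_nhds_zero_nat
      rw [sub_zero] at h
      refine h.congr' ?_
      filter_upwards [Filter.eventually_gt_atTop 0] with N hN
      have hN' : (N : ℝ) ≠ 0 := by exact_mod_cast hN.ne'
      field_simp
    have hDlim : Filter.Tendsto D Filter.atTop (nhds (γ * (1 * L))) := by
      have h := (tendsto_const_nhds (x := γ)).mul (hfrac.mul hDCT)
      refine h.congr' ?_
      filter_upwards [Filter.eventually_ge_atTop 2] with N hN
      have hN' : (N : ℝ) ≠ 0 := by
        have : (2 : ℝ) ≤ N := by exact_mod_cast hN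
        linarith
      rw [hDN N hN]
      have hfun : (fun t : ℝ => (N : ℝ) * Φ N t * (2 * t / (γ ^ 2 + t ^ 2) ^ 2)) =
          fun t : ℝ => (N : ℝ) * (Φ N t * (2 * t / (γ ^ 2 + t ^ 2) ^ 2)) := by
        funext t; ring
      rw [hfun, MeasureTheory.integral_const_mul]
      generalize (∫ t in Set.Ioi (0 : ℝ), Φ N t * (2 * t / (γ ^ 2 + t ^ 2) ^ 2)) = I
      have hI : ((N : ℝ) - 1) / N * ((N : ℝ) * I) = ((N : ℝ) - 1) * I := by
        field_simp
      rw [hI]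
      ring
    have hγL : γ * (1 * L) = γ * L := by ring
    rw [hγL] at hDlim
    obtain ⟨c, hc, N₁, hN₁⟩ := hP ω₂ lam β γ hω hl hβ hγ huniq μ₀ hμ₀ T hT D hD
    have hcL : c ≤ γ * L := ge_of_tendsto hDlim (Filter.eventually_atTop.2 ⟨N₁, hN₁⟩)
    exact ⟨γ * L, lt_of_lt_of_le hc hcL, D, hD, hDlim⟩
  choose κf hκpos Df hDf hDlim using key
  refine ⟨fun T => if hT : 0 < T then κf T hT else 1, fun T hT => ?_, ?_⟩
  · simp only [dif_pos hT]; exact hκpos T hT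
  intro μ hμ T hT
  refine ⟨Df T hT, fun N => ?_, ?_⟩
  ·
    refine (hDf T hT N).congr' ?_
    have h2 : ∀ᶠ δ in nhds (0 : ℝ), δ < 2 * T := eventually_lt_nhds (by linarith)
    have h2' : ∀ᶠ δ in nhds (0 : ℝ), -(2 * T) < δ := eventually_gt_nhds (by linarith)
    filter_upwards [mem_nhdsWithin_of_mem_nhds h2, mem_nhdsWithin_of_mem_nhds h2'] with δ hlt hgt
    have ha : 0 < T + δ / 2 := by linarith
    have hb : 0 < T - δ / 2 := by linarith
    rw [huniq N _ _ ha hb (μ₀ N _ _) (μ N _ _) (hμ₀ N _ _ ha hb) (hμ N _ _ ha hb)]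
  · simp only [dif_pos hT]; exact hDlim T hT

end Summit.AtomisticToContinuum.FouriersLaw.Cruxes.ContactUpperDensity.Recut
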